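import Summits.NavierStokesRegularity.NavierStokesRegularity.Theorems.LerayQuarterDissipationFiniteDissipationLiouvilleApexClasses
import Literature.Analysis.FluidPDE.VeryWeakToDistributional
import HarnessLib

/-!
# Crux `FiniteDissipationLiouville` (stmt-NavierStokesRegularity-22144): decay at spatial infinity
# of a member of the finite-dissipation stratum, through the apex (file 2b/3 of the final-slice leaf)

Theorems file of route `LerayQuarterDissipation` (lead prover g3; `--supports` the crux). Navier–Stokes
regularity is NOT proved by anything here; no summit is.

For a member `u` of the stratum `𝒟` (Type-I ancient mild in the KNSS gauge with Leray's quarter-rate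
dissipation law) and `T, R > 0`:

  `∫₋ₜ⁰ ∫_{B(x₀,R)} |u|² → 0` as `|x₀| → ∞`   (`tendsto_lintegral_slab_ball_cocompact`),

clause (7) of Lemarié-Rieusset's local Leray class (Def. 14.1; Kang–Miura–Tsai Def. 3.2 (7)) for the
field shifted to `(0, T)`, THROUGH the singular time. Proof: Hölder on the ball,
`∫_{B(x₀,R)} |u(t)|² ≤ (∫_{|x|>n} |u(t)|⁶)^{1/3} |B_R|^{2/3}` once `|x₀| > n + R`; the tails of
`|u(t)|⁶ ∈ L¹` tend to `0` for every `t < 0` (`tendsto_setLIntegral_compl_closedBall`), and dominated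
convergence in time against the integrable majorant `‖u(t)‖²_{L⁶} |B_R|^{2/3} ≲ (−t)^{−1/2}`
(`exists_eLpNorm_six_rate`).

References: P. G. Lemarié-Rieusset, *The Navier–Stokes Problem in the 21st Century* (2016), Def. 14.1;
K. Kang, H. Miura, T.-P. Tsai, IMRN 2021, Def. 3.2.
-/

noncomputable section

-- the summit and its single sub-problem share the name (CONVENTIONS §1), as in every Theorems file
set_option linter.dupNamespace false

namespace Summit.NavierStokesRegularity.NavierStokesRegularity.Theorems.FiniteDissipationLiouville.Birth.Apex

open MeasureTheory Set Filter Topology Metric Function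
open Literature.Analysis Literature.Analysis.FluidPDE
open scoped ENNReal NNReal

variable {C K : ℝ} {u : ℝ → EuclideanSpace ℝ (Fin 3) → EuclideanSpace ℝ (Fin 3)}

/-! ### Tails of integrable functions -/

/-- **The tails of a finite integral vanish**: `∫_{|x| > n} g → 0` for `∫ g < ∞`. -/
theorem tendsto_setLIntegral_compl_closedBall {g : EuclideanSpace ℝ (Fin 3) → ℝ≥0∞}
    (hfin : ∫⁻ x, g x ≠ ⊤) :
    Tendsto (fun n : ℕ => ∫⁻ x in (closedBall (0 : EuclideanSpace ℝ (Fin 3)) (n : ℝ))ᶜ, g x)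
      atTop (𝓝 0) := by
  set μ : Measure (EuclideanSpace ℝ (Fin 3)) := volume.withDensity g with hμ
  set s : ℕ → Set (EuclideanSpace ℝ (Fin 3)) := fun n => (closedBall (0 : EuclideanSpace ℝ (Fin 3)) (n : ℝ))ᶜ
    with hs
  have hμs : ∀ n, μ (s n) = ∫⁻ x in (closedBall (0 : EuclideanSpace ℝ (Fin 3)) (n : ℝ))ᶜ, g x :=
    fun n => withDensity_apply _ measurableSet_closedBall.compl
  have hanti : Antitone s := by
    intro m n hmn x hx
    simp only [hs, mem_compl_iff, mem_closedBall, dist_zero_right, not_le] at hx ⊢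
    exact lt_of_le_of_lt (Nat.cast_le.2 hmn) hx
  have hfin0 : ∃ n, μ (s n) ≠ ⊤ := by
    refine ⟨0, ne_top_of_le_ne_top hfin ?_⟩
    rw [hμs]
    exact setLIntegral_le_lintegral _ _
  have h := tendsto_measure_iInter_atTop (μ := μ)
    (fun n => (measurableSet_closedBall.compl : MeasurableSet (s n)).nullMeasurableSet) hanti hfin0
  have he : (⋂ n, s n) = ∅ := by
    ext x
    simp only [hs, mem_iInter, mem_compl_iff, mem_closedBall, dist_zero_right, not_le,
      mem_empty_iff_false, iff_false, not_forall, not_lt]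
    exact exists_nat_ge ‖x‖
  rw [he, measure_empty] at h
  refine h.congr fun n => ?_
  exact hμs n

/-! ### Hölder on a ball against the `L⁶` norm -/

/-- `∫_{B} ‖v‖² ≤ (∫_{B} ‖v‖⁶)^{1/3} · |B|^{2/3}` (Hölder). -/
theorem lintegral_ball_sq_le_rpow {v : EuclideanSpace ℝ (Fin 3) → EuclideanSpace ℝ (Fin 3)}
    (hv : AEMeasurable (fun x => ‖v x‖ₑ) volume) (B : Set (EuclideanSpace ℝ (Fin 3))) :
    ∫⁻ x in B, ‖v x‖ₑ ^ 2 ≤ (∫⁻ x in B, ‖v x‖ₑ ^ 6) ^ (1 / 3 : ℝ) * volume B ^ (2 / 3 : ℝ) := by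
  have hpq : Real.HolderConjugate (3 : ℝ) (3 / 2) := ⟨by norm_num, by norm_num, by norm_num⟩
  have hf : AEMeasurable (fun x => ‖v x‖ₑ ^ 2) (volume.restrict B) := (hv.pow_const 2).restrict
  have h := setLIntegral_le_lintegral_rpow_mul_measure_rpow (μ := volume.restrict B) hf
    MeasurableSet.univ hpq
  rw [Measure.restrict_univ, Measure.restrict_apply_univ] at h
  have e6 : ∀ x, (‖v x‖ₑ ^ 2) ^ (3 : ℝ) = ‖v x‖ₑ ^ 6 := fun x => by
    rw [show (3 : ℝ) = ((3 : ℕ) : ℝ) by norm_num, ENNReal.rpow_natCast, ← pow_mul]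
  simp only [e6] at h
  have e23 : (1 / (3 / 2 : ℝ)) = (2 / 3 : ℝ) := by norm_num
  rw [e23] at h
  exact h

/-! ### The measurable extension by zero -/

/-- The extension of `u` by `0` to `t ≥ 0` is (jointly) measurable: `u` is continuous on the open
slab `t < 0`. -/
theorem measurable_extendByZero (hu : IsTypeIAncientMild C u) :
    Measurable (fun z : ℝ × EuclideanSpace ℝ (Fin 3) => if z.1 < 0 then u z.1 z.2 else 0) := by
  refine measurable_of_restrict_of_restrict_compl
    (s := Iio (0 : ℝ) ×ˢ (univ : Set (EuclideanSpace ℝ (Fin 3))))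
    (measurableSet_Iio.prod MeasurableSet.univ) ?_ ?_
  · have hc : ContinuousOn (fun z : ℝ × EuclideanSpace ℝ (Fin 3) => if z.1 < 0 then u z.1 z.2 else 0)
        (Iio 0 ×ˢ univ) := by
      refine hu.continuousOn_uncurry.congr fun z hz => ?_
      have hz1 : z.1 < 0 := (mem_prod.1 hz).1
      simp only [hz1, if_true, uncurry]
    exact hc.restrict.measurable
  · have h0 : (Iio (0 : ℝ) ×ˢ (univ : Set (EuclideanSpace ℝ (Fin 3))))ᶜ.restrict
        (fun z : ℝ × EuclideanSpace ℝ (Fin 3) => if z.1 < 0 then u z.1 z.2 else 0) = fun _ => 0 := by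
      funext z
      have hz : ¬ (z : ℝ × EuclideanSpace ℝ (Fin 3)).1 < 0 := fun h => z.2 ⟨h, mem_univ _⟩
      simp only [restrict_apply, hz, if_false]
    rw [h0]
    exact measurable_const

/-! ### Decay at spatial infinity through the apex -/

/-- `∫ ‖u(t)‖ₑ⁶ = ‖u(t)‖_{L⁶}⁶` (natural power form). -/
theorem lintegral_enorm_pow_six_eq {v : EuclideanSpace ℝ (Fin 3) → EuclideanSpace ℝ (Fin 3)}
    (hv : AEStronglyMeasurable v volume) :
    ∫⁻ x, ‖v x‖ₑ ^ 6 = eLpNorm v (ENNReal.ofReal 6) volume ^ (6 : ℝ) := by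
  have e6 : ENNReal.ofReal (6 : ℝ) = 6 := by norm_num
  rw [e6, eLpNorm_eq_lintegral_rpow_enorm_toReal (by norm_num) (by norm_num), ← ENNReal.rpow_mul]
  have e1 : (6 : ℝ≥0∞).toReal = 6 := by norm_num
  rw [e1, show (1 / (6 : ℝ)) * 6 = 1 by norm_num, ENNReal.rpow_one]
  refine lintegral_congr fun x => ?_
  have _ := hv
  exact (ENNReal.rpow_natCast _ 6).symm.trans (by norm_num)

/-- **Clause (7) of the local Leray class, through the apex**: for a member of the stratum and
`T, R > 0`, `∫₋ₜ⁰ ∫_{B(x₀,R)} |u|² → 0` as `|x₀| → ∞` (Hölder on the ball against the tails of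
`|u(t)|⁶ ∈ L¹`, dominated convergence in time against `|B_R|^{2/3} ‖u(t)‖₆² ≲ (−t)^{−1/2}`). -/
theorem tendsto_lintegral_slab_ball_cocompact (hu : IsTypeIAncientMild C u)
    (hlaw : ∀ s : ℝ, s < 0 → ∫⁻ x, ‖fderiv ℝ (u s) x‖ₑ ^ 2 ≤ ENNReal.ofReal (K / Real.sqrt (-s)))
    (T R : ℝ) :
    Tendsto (fun x₀ : EuclideanSpace ℝ (Fin 3) =>
      ∫⁻ z in Ioo (-T) 0 ×ˢ ball x₀ R, ‖u z.1 z.2‖ₑ ^ 2) (cocompact (EuclideanSpace ℝ (Fin 3))) (𝓝 0) := by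
  obtain ⟨A, hA0, hA⟩ := exists_eLpNorm_six_rate hu hlaw
  set κ : ℝ := (6 - 3) / (2 * 6) with hκ
  -- the measurable extension and the volume of the balls
  set U : ℝ × EuclideanSpace ℝ (Fin 3) → EuclideanSpace ℝ (Fin 3) :=
    fun z => if z.1 < 0 then u z.1 z.2 else 0 with hU
  have hUm : Measurable U := measurable_extendByZero hu
  have hUeq : ∀ t < 0, ∀ x, U (t, x) = u t x := fun t ht x => by simp [hU, ht]
  have hU6m : Measurable fun z : ℝ × EuclideanSpace ℝ (Fin 3) => ‖U z‖ₑ ^ 6 := hUm.enorm.pow_const 6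
  have hU2m : Measurable fun z : ℝ × EuclideanSpace ℝ (Fin 3) => ‖U z‖ₑ ^ 2 := hUm.enorm.pow_const 2
  set V : ℝ≥0∞ := volume (ball (0 : EuclideanSpace ℝ (Fin 3)) R) with hV
  have hVx : ∀ x₀ : EuclideanSpace ℝ (Fin 3), volume (ball x₀ R) = V := fun x₀ =>
    Measure.addHaar_ball_center volume x₀ R
  have hVtop : V ^ (2 / 3 : ℝ) ≠ ⊤ :=
    ENNReal.rpow_ne_top_of_nonneg (by norm_num) measure_ball_lt_top.ne
  -- the tail functions and the majorant
  set G : ℕ → ℝ → ℝ≥0∞ := fun n t =>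
    (∫⁻ x in (closedBall (0 : EuclideanSpace ℝ (Fin 3)) (n : ℝ))ᶜ, ‖U (t, x)‖ₑ ^ 6) ^ (1 / 3 : ℝ) *
      V ^ (2 / 3 : ℝ) with hG
  set H : ℝ → ℝ≥0∞ := fun t => ENNReal.ofReal (A * (-t) ^ (-κ)) ^ 2 * V ^ (2 / 3 : ℝ) with hH
  -- (i) measurability of the tail functions
  have hGm : ∀ n, Measurable (G n) := by
    intro n
    have h2 : Measurable fun t : ℝ =>
        ∫⁻ x in (closedBall (0 : EuclideanSpace ℝ (Fin 3)) (n : ℝ))ᶜ, ‖U (t, x)‖ₑ ^ 6 :=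
      hU6m.lintegral_prod_right'
    exact ((ENNReal.continuous_rpow_const.measurable.comp h2).mul_const _)
  -- (ii) the bound `G n t ≤ H t` on `(−T, 0)`
  have h6 : ∀ t < 0, ∫⁻ x, ‖u t x‖ₑ ^ 6 ≤ ENNReal.ofReal (A * (-t) ^ (-κ)) ^ (6 : ℝ) := by
    intro t ht
    rw [lintegral_enorm_pow_six_eq (hA t ht).1.1]
    exact ENNReal.rpow_le_rpow (hA t ht).2 (by norm_num)
  have hGH : ∀ n, ∀ t < 0, G n t ≤ H t := by
    intro n t ht
    have h1 : ∫⁻ x in (closedBall (0 : EuclideanSpace ℝ (Fin 3)) (n : ℝ))ᶜ, ‖U (t, x)‖ₑ ^ 6 ≤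
        ENNReal.ofReal (A * (-t) ^ (-κ)) ^ (6 : ℝ) := by
      calc ∫⁻ x in (closedBall (0 : EuclideanSpace ℝ (Fin 3)) (n : ℝ))ᶜ, ‖U (t, x)‖ₑ ^ 6
          ≤ ∫⁻ x, ‖U (t, x)‖ₑ ^ 6 := setLIntegral_le_lintegral _ _
        _ = ∫⁻ x, ‖u t x‖ₑ ^ 6 := by simp only [hUeq t ht]
        _ ≤ _ := h6 t ht
    have h2 : (ENNReal.ofReal (A * (-t) ^ (-κ)) ^ (6 : ℝ)) ^ (1 / 3 : ℝ) =
        ENNReal.ofReal (A * (-t) ^ (-κ)) ^ 2 := by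
      rw [← ENNReal.rpow_mul, show (6 : ℝ) * (1 / 3) = 2 by norm_num, ENNReal.rpow_two]
    calc G n t ≤ (ENNReal.ofReal (A * (-t) ^ (-κ)) ^ (6 : ℝ)) ^ (1 / 3 : ℝ) * V ^ (2 / 3 : ℝ) := by
          simp only [hG]
          gcongr
      _ = H t := by rw [h2]
  -- (iii) the majorant is integrable on `(−T, 0)`
  have hHfin : ∫⁻ t in Ioo (-T) 0, H t ≠ ⊤ := by
    have hint : IntegrableOn (fun s : ℝ => A ^ 2 * (-s) ^ (-(3 * (1 / 6 : ℝ)))) (Ioo (-T) 0) :=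
      (ChaeWolfEnergy.integrableOn_rpow_neg_Ioo (by norm_num) _).const_mul _
    have hle : ∀ t ∈ Ioo (-T) 0, H t = ENNReal.ofReal (A ^ 2 * (-t) ^ (-(3 * (1 / 6 : ℝ)))) *
        V ^ (2 / 3 : ℝ) := by
      intro t ht
      have ht0 : 0 < -t := by linarith [ht.2]
      obtain ⟨i2, -, -⟩ := ChaeWolfEnergy.rate_pow_identities (κ := κ) (C := 0) hA0 le_rfl ht0
      have e : -(2 * κ) = -(3 * (1 / 6 : ℝ)) := by rw [hκ]; norm_num
      rw [hH]
      simp only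
      rw [← ENNReal.ofReal_pow (mul_nonneg hA0 (Real.rpow_nonneg ht0.le _)), i2, e]
    calc ∫⁻ t in Ioo (-T) 0, H t
        = ∫⁻ t in Ioo (-T) 0, ENNReal.ofReal (A ^ 2 * (-t) ^ (-(3 * (1 / 6 : ℝ)))) * V ^ (2 / 3 : ℝ) :=
          setLIntegral_congr_fun measurableSet_Ioo hle
      _ = (∫⁻ t in Ioo (-T) 0, ENNReal.ofReal (A ^ 2 * (-t) ^ (-(3 * (1 / 6 : ℝ))))) * V ^ (2 / 3 : ℝ) :=
          lintegral_mul_const' _ _ hVtop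
      _ ≠ ⊤ := by
          refine ENNReal.mul_ne_top ?_ hVtop
          rw [← ofReal_integral_eq_lintegral_ofReal hint]
          · exact ENNReal.ofReal_ne_top
          · refine (ae_restrict_iff' measurableSet_Ioo).2 (ae_of_all _ fun s hs => ?_)
            exact mul_nonneg (sq_nonneg _) (Real.rpow_nonneg (by linarith [hs.2]) _)
  -- (iv) the tails vanish for every `t < 0`
  have hGlim : ∀ t < 0, Tendsto (fun n => G n t) atTop (𝓝 0) := by
    intro t ht
    have hfin : ∫⁻ x, ‖U (t, x)‖ₑ ^ 6 ≠ ⊤ := by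
      simp only [hUeq t ht]
      exact ne_top_of_le_ne_top (ENNReal.rpow_ne_top_of_nonneg (by norm_num) ENNReal.ofReal_ne_top)
        (h6 t ht)
    have htail := tendsto_setLIntegral_compl_closedBall hfin
    have h1 : Tendsto (fun n : ℕ => (∫⁻ x in (closedBall (0 : EuclideanSpace ℝ (Fin 3)) (n : ℝ))ᶜ,
        ‖U (t, x)‖ₑ ^ 6) ^ (1 / 3 : ℝ)) atTop (𝓝 0) := by
      have h := ((ENNReal.continuous_rpow_const (y := (1 / 3 : ℝ))).tendsto 0).comp htail
      rwa [ENNReal.zero_rpow_of_pos (by norm_num)] at h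
    have h2 := ENNReal.Tendsto.mul_const h1 (Or.inr hVtop)
    rwa [zero_mul] at h2
  -- (v) dominated convergence in time
  have hDCT : Tendsto (fun n => ∫⁻ t in Ioo (-T) 0, G n t) atTop (𝓝 0) := by
    have h := tendsto_lintegral_filter_of_dominated_convergence (μ := volume.restrict (Ioo (-T) 0))
      (l := atTop) (F := G) (f := fun _ => 0) H
      (Eventually.of_forall hGm)
      (Eventually.of_forall fun n => (ae_restrict_iff' measurableSet_Ioo).2
        (ae_of_all _ fun t ht => hGH n t ht.2))
      hHfin
      ((ae_restrict_iff' measurableSet_Ioo).2 (ae_of_all _ fun t ht => hGlim t ht.2))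
    simpa using h
  -- (vi) conclusion
  refine ENNReal.tendsto_nhds_zero.2 fun ε hε => ?_
  obtain ⟨n, hn⟩ := (hDCT.eventually (Iic_mem_nhds hε)).exists
  have hmem : {x₀ : EuclideanSpace ℝ (Fin 3) | (n : ℝ) + R < ‖x₀‖} ∈
      cocompact (EuclideanSpace ℝ (Fin 3)) := by
    refine mem_of_superset ((isCompact_closedBall (0 : EuclideanSpace ℝ (Fin 3))
      ((n : ℝ) + R)).compl_mem_cocompact) ?_
    intro x hx
    rw [mem_compl_iff, mem_closedBall, dist_zero_right, not_le] at hx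
    exact hx
  filter_upwards [hmem] with x₀ hx₀
  have hballsub : ball x₀ R ⊆ (closedBall (0 : EuclideanSpace ℝ (Fin 3)) (n : ℝ))ᶜ := by
    intro y hy
    rw [mem_compl_iff, mem_closedBall, dist_zero_right, not_le]
    rw [mem_ball, dist_eq_norm] at hy
    have := norm_sub_norm_le x₀ y
    have : ‖x₀ - y‖ = ‖y - x₀‖ := norm_sub_rev _ _
    linarith
  -- Tonelli on the box and the slice Hölder bound
  have hprod : (volume : Measure (ℝ × EuclideanSpace ℝ (Fin 3))).restrict (Ioo (-T) 0 ×ˢ ball x₀ R) =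
      ((volume : Measure ℝ).restrict (Ioo (-T) 0)).prod
        ((volume : Measure (EuclideanSpace ℝ (Fin 3))).restrict (ball x₀ R)) :=
    volume_restrict_prod_eq _ _
  have hbox : ∫⁻ z in Ioo (-T) 0 ×ˢ ball x₀ R, ‖u z.1 z.2‖ₑ ^ 2 =
      ∫⁻ t in Ioo (-T) 0, ∫⁻ x in ball x₀ R, ‖U (t, x)‖ₑ ^ 2 := by
    have e1 : ∫⁻ z in Ioo (-T) 0 ×ˢ ball x₀ R, ‖u z.1 z.2‖ₑ ^ 2 =
        ∫⁻ z in Ioo (-T) 0 ×ˢ ball x₀ R, ‖U z‖ₑ ^ 2 := by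
      refine setLIntegral_congr_fun (measurableSet_Ioo.prod measurableSet_ball) fun z hz => ?_
      rw [show U z = u z.1 z.2 from hUeq z.1 (mem_prod.1 hz).1.2 z.2]
    rw [e1, hprod, lintegral_prod _ hU2m.aemeasurable]
  rw [hbox]
  calc ∫⁻ t in Ioo (-T) 0, ∫⁻ x in ball x₀ R, ‖U (t, x)‖ₑ ^ 2
      ≤ ∫⁻ t in Ioo (-T) 0, G n t := by
        refine setLIntegral_mono' measurableSet_Ioo fun t ht => ?_
        have hUt : AEMeasurable (fun x => ‖U (t, x)‖ₑ) volume :=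
          (hUm.comp (measurable_const.prodMk measurable_id)).enorm.aemeasurable
        calc ∫⁻ x in ball x₀ R, ‖U (t, x)‖ₑ ^ 2
            ≤ (∫⁻ x in ball x₀ R, ‖U (t, x)‖ₑ ^ 6) ^ (1 / 3 : ℝ) * volume (ball x₀ R) ^ (2 / 3 : ℝ) :=
              lintegral_ball_sq_le_rpow (v := fun x => U (t, x)) hUt _
          _ ≤ G n t := by
              rw [hVx x₀]
              simp only [hG]
              gcongr ?_ ^ _ * _
              exact lintegral_mono_set hballsub
    _ ≤ ε := hn

end Summit.NavierStokesRegularity.NavierStokesRegularity.Theorems.FiniteDissipationLiouville.Birth.Apex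

end
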